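import Summits.ResolutionOfSingularities.ResolutionOfSingularities.Theorems.FrobeniusLadderFInjectiveMacaulayficationCNConeFiModel
import Summits.ResolutionOfSingularities.ResolutionOfSingularities.Theorems.FrobeniusLadderFInjectiveMacaulayficationMonomialChartPresentationPrime
import HarnessLib

/-!
# G5ᴾ without the divisibility side condition: `CNConeFiModel` for a prime hypersurface (crux `FInjectiveMacaulayfication`, §18)

Support file for crux stmt-ResolutionOfSingularities-15315 (`FrobeniusLadder.FInjectiveMacaulayfication`), §18 THE CN ENGINE IN
GLOBAL FORM (skeleton v18 `5cf0aca3`; lead seat res-L1-w45a-lead-1 gen 2). [OURS · L1 W4.5a] — AI-written; not a statement of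
any manuscript.

`CNConeFiModel.cnConeFiModel` (stub-3 p495573 = planner (C0) v4 §3) carries, per vertex chart `c`, the decidable divisibility
`hunit_c : x^{Σᵢ dᵢ•a_c i} ∣ (x^{m_c})^N` inherited from stub-1's chart presentation. It is UNNECESSARY: the chart presentation holds
for every PRIME `f` with no `x̄ⱼ = 0` (`MonomialChartPresentationPrime.exists_monomialChartPresentation_of_isPrime`, p495258 — the
kernel inclusion by the domain argument), and those hypotheses are already in the statement. `cnConeFiModel_of_isPrime` is
`cnConeFiModel` with the `hunit` line deleted (proof = stub-3's, one call swapped); it can fail for pure-power vertex charts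
`x^{m_c} = X_j^e` otherwise, so specimen typers (Q6 on Σ′ first) should instantiate THIS form. No definitions, no named facts. [folklore]
-/

set_option linter.dupNamespace false

noncomputable section

open AlgebraicGeometry CategoryTheory Literature.AlgebraicGeometry.Resolution MvPolynomial

namespace Summit.ResolutionOfSingularities.ResolutionOfSingularities.Theorems.FInjectiveMacaulayfication.CNConeFiModelPrime

open Summit.ResolutionOfSingularities.ResolutionOfSingularities.Theorems.FInjectiveMacaulayfication

set_option maxHeartbeats 800000 in
/-- **`CNConeFiModel` for a prime hypersurface, no `hunit`** (module docstring): the blow-up of `Spec k[X]/(f)` in ONE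
`𝔪`-primary monomial ideal `I_A`, covered by unimodular vertex charts, is a proper birational model whose stalks are CM domains with
all parameter ideals Frobenius closed — given the clause off the origin and the Cartier–Newton face conditions. [folklore] -/
theorem cnConeFiModel_of_isPrime :
    ∀ (p : ℕ) [Fact p.Prime] (k : Type) [Field k] [CharP k p] (n : ℕ), 0 < n →
    ∀ (A : Finset (Fin n →₀ ℕ)), (0 : Fin n →₀ ℕ) ∉ A →
    (∀ j : Fin n, ∃ e : ℕ, 0 < e ∧ Finsupp.single j e ∈ A) →
    ∀ (t : ℕ), 0 < t → ∀ (V : Fin t → Matrix (Fin n) (Fin n) ℕ), (∀ c, IsUnit ((V c).map (Nat.cast : ℕ → ℤ)).det) →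
    ∀ (m : Fin t → (Fin n →₀ ℕ)), (∀ c, m c ∈ A) →
    ∀ (a : Fin t → Fin n → (Fin n →₀ ℕ)), (∀ c i, a c i ∈ A) →
    (∀ (c : Fin t) (i : Fin n), (Finsupp.equivFunOnFinite.symm ((V c).mulVec ⇑(a c i)) : Fin n →₀ ℕ) =
      Finsupp.equivFunOnFinite.symm ((V c).mulVec ⇑(m c)) + Finsupp.single i 1) →
    (∀ (c : Fin t), ∀ e ∈ A, (Finsupp.equivFunOnFinite.symm ((V c).mulVec ⇑(m c)) : Fin n →₀ ℕ) ≤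
      Finsupp.equivFunOnFinite.symm ((V c).mulVec ⇑e)) →
    (∀ e ∈ A, ∃ (c : Fin t) (K : ℕ), 1 ≤ K ∧ ∃ y ∈ (Ideal.span ((fun b : Fin n →₀ ℕ => (MvPolynomial.monomial b (1 : k) : MvPolynomial (Fin n) k)) '' (A : Set (Fin n →₀ ℕ)))) ^ (K - 1),
      (MvPolynomial.monomial e (1 : k) : MvPolynomial (Fin n) k) ^ K = MvPolynomial.monomial (m c) 1 * y) →
    ∀ (f : MvPolynomial (Fin n) k), (Ideal.span {f}).IsPrime →
    (∀ v : Fin n, Ideal.Quotient.mk (Ideal.span {f}) (MvPolynomial.X v) ≠ 0) →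
    (∀ (Q : Ideal (MvPolynomial (Fin n) k ⧸ Ideal.span {f})) [Q.IsMaximal],
      (∃ j : Fin n, Ideal.Quotient.mk (Ideal.span {f}) (MvPolynomial.X j) ∉ Q) →
      ∀ d : ℕ, ringKrullDim (Localization.AtPrime Q) = d → ∀ s : Fin d → Localization.AtPrime Q,
        (Ideal.span (Set.range s)).radical.IsMaximal →
          RingTheory.Sequence.IsWeaklyRegular (Localization.AtPrime Q) (List.ofFn s) ∧
          ∀ y : Localization.AtPrime Q, (∃ e : ℕ, y ^ p ^ e ∈ Ideal.span
            ((fun z : Localization.AtPrime Q => z ^ p ^ e) ''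
              (Ideal.span (Set.range s) : Set (Localization.AtPrime Q)))) → y ∈ Ideal.span (Set.range s)) →
    (∀ (c : Fin t) (S : Finset (Fin n)), (∀ j : Fin n, 0 < ∑ i ∈ S, V c i j) →
      (∀ D : ℕ, (MvPolynomial.weightedHomogeneousComponent (fun j : Fin n => ∑ i ∈ S, V c i j) D f ≠ 0 ∧
          ∀ D' < D, MvPolynomial.weightedHomogeneousComponent (fun j : Fin n => ∑ i ∈ S, V c i j) D' f = 0) →
        ∀ (K : Type) [Field K] [Algebra k K] (b : Fin n → K), (∀ i, b i ≠ 0) →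
          MvPolynomial.aeval b (MvPolynomial.weightedHomogeneousComponent (fun j : Fin n => ∑ i ∈ S, V c i j) D f) = 0 →
          (MvPolynomial.map (algebraMap k K) (MvPolynomial.weightedHomogeneousComponent (fun j : Fin n => ∑ i ∈ S, V c i j) D f)) ^ (p - 1) ∉
            Ideal.span (Set.range fun i : Fin n => (MvPolynomial.X i - MvPolynomial.C (b i)) ^ p))) →
    ∀ (dv : Fin t → (Fin n →₀ ℕ)) (g : Fin t → MvPolynomial (Fin n) k),
    (∀ c, MvPolynomial.aeval (fun j : Fin n => ∏ i : Fin n, (MvPolynomial.X i : MvPolynomial (Fin n) k) ^ V c i j) f = MvPolynomial.monomial (dv c) 1 * g c) →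
    (∀ c, ∀ i : Fin n, ¬ (MvPolynomial.X i ∣ g c)) →
    (∀ c, ∃ m ∈ f.support, ∀ i : Fin n, ∑ j : Fin n, V c i j * m j = dv c i) →
    ∃ (X' : Scheme.{0}) (π : X' ⟶ Spec (.of (MvPolynomial (Fin n) k ⧸ Ideal.span {f}))), IsProper π ∧
      Literature.AlgebraicGeometry.Resolution.IsBirational π ∧
      ∀ y : X', IsDomain (X'.presheaf.stalk y) ∧ ∀ d : ℕ, ringKrullDim (X'.presheaf.stalk y) = d →
        ∀ s : Fin d → X'.presheaf.stalk y, (Ideal.span (Set.range s)).radical.IsMaximal →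
          RingTheory.Sequence.IsWeaklyRegular (X'.presheaf.stalk y) (List.ofFn s) ∧
          ∀ z : X'.presheaf.stalk y, (∃ e : ℕ, z ^ p ^ e ∈
              Ideal.span ((fun w : X'.presheaf.stalk y => w ^ p ^ e) ''
                (Ideal.span (Set.range s) : Set (X'.presheaf.stalk y)))) →
            z ∈ Ideal.span (Set.range s) := by
  intro p _ k _ _ n hn A hA0 hprim t ht V hV m hm a haA hgen hge hcov f hfprime hXne hoff hCN dv g hg hndiv hface
  refine CNConeFiModel.cnConeFiModel_of_chartClause p k n A hA0 t ht m hm hcov f hfprime hXne hoff ?_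
  intro c Q _ hQ
  haveI := hfprime
  haveI : IsDomain (MvPolynomial (Fin n) k ⧸ Ideal.span {f}) := Ideal.Quotient.isDomain _
  have hg0 : g c ≠ 0 := fun h0 => hndiv c ⟨0, hn⟩ (h0 ▸ dvd_zero _)
  -- the presentation of chart `c` (C1, landed), upgraded to a ring equivalence
  obtain ⟨e₀, hbij, heθ⟩ := MonomialChartPresentationPrime.exists_monomialChartPresentation_of_isPrime f (V c) (hV c) (m c) (a c)
    (hgen c) A (haA c) (hge c) (dv c) (g c) (hg c) hfprime hXne (hndiv c)
  obtain ⟨e, he⟩ : ∃ e : (MvPolynomial (Fin n) k ⧸ Ideal.span {g c}) ≃+* ↥(blowupAlgebra (Ideal.span ((fun b : Fin n →₀ ℕ => Ideal.Quotient.mk (Ideal.span {f}) (MvPolynomial.monomial b (1 : k))) '' (A : Set (Fin n →₀ ℕ)))) (Ideal.Quotient.mk (Ideal.span {f}) (MvPolynomial.monomial (m c) 1))),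
      ∀ x, e x = e₀ x := ⟨RingEquiv.ofBijective e₀ hbij, fun x => rfl⟩
  -- `(g c)` is prime: `k[y]/(g c)` is isomorphic to a subring of the domain `R[1/x̄^(m c)]`
  haveI : IsDomain (Localization.Away (Ideal.Quotient.mk (Ideal.span {f}) (MvPolynomial.monomial (m c) (1 : k)))) :=
    IsLocalization.isDomain_localization
      (powers_le_nonZeroDivisors_of_noZeroDivisors (CNConeFiModel.mk_monomial_ne_zero f hXne (m c)))
  haveI : IsDomain (MvPolynomial (Fin n) k ⧸ Ideal.span {g c}) := e.toMulEquiv.isDomain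
  haveI hgp : (Ideal.span {g c}).IsPrime := (Ideal.Quotient.isDomain_iff_prime _).mp inferInstance
  -- `Q' = e⁻¹ Q` is maximal
  haveI hQ' : (Q.comap e.toRingHom).IsMaximal := Ideal.comap_isMaximal_of_equiv e
  -- every `θ(X_j)` lies in `Q'`: `(x̄ⱼ/1)^ε = (x̄ⱼ^ε/x̄^m) · (x̄^m/1) ∈ Q`
  have hXQ : ∀ j : Fin n,
      Ideal.Quotient.mk (Ideal.span {g c}) (∏ i : Fin n, MvPolynomial.X i ^ V c i j) ∈ Q.comap e.toRingHom := by
    intro j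
    obtain ⟨ε, hε, hεA⟩ := hprim j
    have hz : algebraMap (MvPolynomial (Fin n) k ⧸ Ideal.span {f}) (Localization.Away (Ideal.Quotient.mk (Ideal.span {f}) (MvPolynomial.monomial (m c) (1 : k))))
        (Ideal.Quotient.mk (Ideal.span {f}) (MvPolynomial.X j ^ ε)) * IsLocalization.Away.invSelf (Ideal.Quotient.mk (Ideal.span {f}) (MvPolynomial.monomial (m c) (1 : k))) ∈
        blowupAlgebra (Ideal.span ((fun b : Fin n →₀ ℕ => Ideal.Quotient.mk (Ideal.span {f}) (MvPolynomial.monomial b (1 : k))) '' (A : Set (Fin n →₀ ℕ)))) (Ideal.Quotient.mk (Ideal.span {f}) (MvPolynomial.monomial (m c) 1)) := by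
      refine div_mem_blowupAlgebra _ _ (Ideal.subset_span ⟨Finsupp.single j ε, hεA, ?_⟩)
      show Ideal.Quotient.mk (Ideal.span {f}) (MvPolynomial.monomial (Finsupp.single j ε) (1 : k)) = _
      rw [X_pow_eq_monomial]
    have hprod : (⟨_, hz⟩ : ↥(blowupAlgebra (Ideal.span ((fun b : Fin n →₀ ℕ => Ideal.Quotient.mk (Ideal.span {f}) (MvPolynomial.monomial b (1 : k))) '' (A : Set (Fin n →₀ ℕ)))) (Ideal.Quotient.mk (Ideal.span {f}) (MvPolynomial.monomial (m c) 1)))) *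
        algebraMap (MvPolynomial (Fin n) k ⧸ Ideal.span {f}) _ (Ideal.Quotient.mk (Ideal.span {f}) (MvPolynomial.monomial (m c) 1)) =
        (algebraMap (MvPolynomial (Fin n) k ⧸ Ideal.span {f}) _ (Ideal.Quotient.mk (Ideal.span {f}) (MvPolynomial.X j))) ^ ε := by
      apply Subtype.ext
      simp only [Subalgebra.coe_mul, Subalgebra.coe_algebraMap, SubmonoidClass.coe_pow]
      rw [← map_pow, ← map_pow]
      exact div_mul_algebraMap _ _
    have hmem : (algebraMap (MvPolynomial (Fin n) k ⧸ Ideal.span {f}) ↥(blowupAlgebra (Ideal.span ((fun b : Fin n →₀ ℕ => Ideal.Quotient.mk (Ideal.span {f}) (MvPolynomial.monomial b (1 : k))) '' (A : Set (Fin n →₀ ℕ)))) (Ideal.Quotient.mk (Ideal.span {f}) (MvPolynomial.monomial (m c) 1))) (Ideal.Quotient.mk (Ideal.span {f}) (MvPolynomial.X j))) ^ ε ∈ Q := by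
      rw [← hprod]
      exact Q.mul_mem_left _ hQ
    have hXjQ := (inferInstance : Q.IsPrime).mem_of_pow_mem _ hmem
    rw [Ideal.mem_comap]
    have hej : e.toRingHom (Ideal.Quotient.mk (Ideal.span {g c}) (∏ i : Fin n, MvPolynomial.X i ^ V c i j)) =
        algebraMap (MvPolynomial (Fin n) k ⧸ Ideal.span {f}) ↥(blowupAlgebra (Ideal.span ((fun b : Fin n →₀ ℕ => Ideal.Quotient.mk (Ideal.span {f}) (MvPolynomial.monomial b (1 : k))) '' (A : Set (Fin n →₀ ℕ)))) (Ideal.Quotient.mk (Ideal.span {f}) (MvPolynomial.monomial (m c) 1))) (Ideal.Quotient.mk (Ideal.span {f}) (MvPolynomial.X j)) := by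
      apply Subtype.ext
      rw [Subalgebra.coe_algebraMap]
      have h1 := heθ (MvPolynomial.X j)
      rw [MvPolynomial.aeval_X] at h1
      rw [RingEquiv.toRingHom_eq_coe, RingHom.coe_coe, he]
      exact h1
    rw [hej]
    exact hXjQ
  -- the clause at `Q'` (G4ᴾ, landed), transported along `k[y]/(g c)_(Q') ≅ (chart)_Q`
  have hcl := CNChartClause.cnChartClause p k n hn f (V c) (hV c) (dv c) (g c) hgp (hg c) hg0
    (fun S hS => hCN c S hS) (hface c) (Q.comap e.toRingHom) hXQ
  obtain ⟨eL⟩ := BlowupFiModelOfCover.nonempty_ringEquiv_localization_of_ringEquiv e (Q.comap e.toRingHom) Q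
    (fun x => Iff.rfl)
  exact DegreeZeroDescent.inlineClause_of_ringEquiv p eL hcl


end Summit.ResolutionOfSingularities.ResolutionOfSingularities.Theorems.FInjectiveMacaulayfication.CNConeFiModelPrime

end
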